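/-
Copyright (c) 2026 the pub-hodgecm-mathlib formalisation cell (harness21).  Prover seat hodgecm-mathlib-A-p19 (g29): road «S3-ram» (LEAD F0P3a-plan (g13); owner ∕ (α) keeper
F0P3a-p06 (g16); (Cnt2′) chair F0P3a-p07 (g15)), the `stub_Zhyp` COMPOSITION PEN (heir-by-taking after F0P3a-p08 (g20)): `sR.card` of the hyperbolic literal, regime B; 2026-09-02.
-/
import Literature.NumberTheory.Rogawski1990.TypeTwoRamifiedFrameLiteralRootRegion          -- ★ p849354 (this seat): FILE 4, root region ↦ A-p12's centred ball; brings FILES 1–3, ★ WSideBalls, ★ DepthDictionary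
import HarnessLib

/-!
# THE ROOT-REGION COUNT `#R` OF THE CENTRED HYPERBOLIC TYPE-(2) LITERAL AT A TAMELY RAMIFIED CM PLACE, REGIME B (`m < N`), BOTH PARITIES OF `N`
# (Kottwitz 1986 §3; Rogawski 1990 §4.9; Labesse–Langlands 1979 §2)

Topic `NumberTheory/Rogawski1990`; namespace `Literature.NumberTheory.Rogawski1990.BlockLawHyp`.  THEOREMS ONLY (no definition, no instance, no notation, no named fact,
no `sorry`); kernel lane `--supports stmt-HodgeConjecture-24833`.  Cell `pub/hodgecm-mathlib` (D-0151), crux H413; road «S3-ram» (count-neutral): the (α) BLOCK-LAW skeleton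
(keeper F0P3a-p06 (g16) v2), hyperbolic cells `stub_Zhyp_zero_{even,odd}_B` ∕ `stub_Zhyp_pm_{even,odd}_B`: their atom **`R = sR.card`** (★ p849287 ∕ p849335, F0P3a-p08
(g20): the region binder `sR` of the raw heads at `Γ = ι(B₀, 1)`, `B₀ = k⁻¹(s·ĝ_w)k`).  THIS FILE gives the NUMBER: with `m = 2k′ + 3` (regime B: `m < N`, `m` odd ≥ 3, ★
chair dictionary) and `N − m = 2a` (`n = a + k′ + 1`), the root region of `Γ` at level `ϖ^m` has
**`(q + 1)·Σ_{i<a} q^i`** members for `N = 2n` and **`2·Σ_{i≤a} q^i − 1`** for `N = 2n + 1` (`q = #𝓀_v`) — ★ FILE 4 `ncard_rootRegion_rerootedCentred_eq_ncard_ball_ram`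
(root region = A-p12's centred ball of `ĝ_w` at scale `ϖ^m`; value gap from `hm`, scalar depth `|2û₀₀ − tr ĝ_w| = |ϖ^m|` from ★ `typeTwo_depthDictionary_{even,odd}_ram`) ∘ ★ A-p12
(g25) `selfDual_fixed_ball_odd_scale_eq` (`ϖ^{2(k′+1)+1} ↝ ϖ^{2(k′+1)}`, `N ≠ 2(k′+1)`) ∘ ★ `ncard_selfDual_fixed_ball_of_{even,odd}_depth_ramified` (`j = k′ + 1`).  These are
the keeper's `R = (q+1)Σ_{i<a}q^i [+ q^a]` texts (odd `N`: `2Σ_{i≤a}q^i − 1 = (q+1)Σ_{i<a}q^i + q^a`).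
HONEST LABEL: HC_CM is proved only modulo the 2 remaining named inputs (hLiu418 24832, h413 24833) until rung 0 closes; unconditional local algebra, count-neutral.

* **`ncard_rootRegion_hyperbolic_of_even_B_ram`** (`N = 2n`, `m = 2k′+3`, `n = a + k′ + 1`): `#R = (q+1)·Σ_{i<a} q^i`;
* **`ncard_rootRegion_hyperbolic_of_odd_B_ram`** (`N = 2n+1`, `m = 2k′+3`, `n = a + k′ + 1`, any `a ≥ 0`): `#R + 1 = 2·Σ_{i<a+1} q^i`.

## References
* [Kottwitz1986] R. E. Kottwitz, *Base change for unit elements of Hecke algebras*, Compositio Math. 60 (1986), §3.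
* [Rogawski1990] J. D. Rogawski, *Automorphic Representations of Unitary Groups in Three Variables*, Ann. of Math. Stud. 123 (1990), §4.9 pp. 54–56, Lemma 4.9.3.
* [LabesseLanglands1979] J.-P. Labesse, R. P. Langlands, *L-indistinguishability for SL(2)*, Canad. J. Math. 31 (1979), §2 Lemma 2.1 p. 8.
-/

set_option autoImplicit false

noncomputable section

open scoped Valued WithZero Matrix MatrixGroups
open Polynomial NumberField IsDedekindDomain
open Literature.NumberTheory.Automorphic Literature.NumberTheory.Automorphic.HermitianLattice Literature.NumberTheory.Automorphic.UnitaryLatticeTree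
open Literature.NumberTheory.Automorphic.UnitaryGroup Literature.NumberTheory.GaloisRepresentations
open Literature.NumberTheory.Rogawski1990

namespace Literature.NumberTheory.Rogawski1990.BlockLawHyp

variable (L : Type) [Field L] [NumberField L] [IsCMField L] {v : HeightOneSpectrum (𝓞 ↥(maximalRealSubfield L))}
  (w : PlacesOver L v) (hw : IsCMField.complexConj L • w.1 = w.1)

set_option maxHeartbeats 800000 in
-- budget only: statement-heavy CM tokens.
/-- **`#R` OF THE HYPERBOLIC LITERAL, `N = 2n`, REGIME B** (`m = 2k′ + 3`, `n = a + k′ + 1`): the root region of `Γ = ι(k⁻¹(s·ĝ_w)k, 1)` at level `ϖ^m` has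
`(q+1)·Σ_{i<a} q^i` members, `q = #(𝓞_{L⁺} ⁄ v)`.  FILE 4 ∘ ★ A-p12 odd-scale collapse ∘ ★ A-p12 even-depth ball count; the scalar depth `|2û₀₀ − tr ĝ_w|_w = |ϖ^m|` is clause 2 of
★ `typeTwo_depthDictionary_even_ram`. [cite: Kottwitz1986, §3] [cite: Rogawski1990, §4.9 Lemma 4.9.3] [cite: LabesseLanglands1979, §2 Lemma 2.1] -/
theorem ncard_rootRegion_hyperbolic_of_even_B_ram (he : v.asIdeal.ramificationIdx' w.1.asIdeal ≠ 1)
    (h2 : IsUnit (2 : (ValuativeRel.valuation (w.1.adicCompletion L)).integer))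
    (ϖ : w.1.adicCompletion L) (hϖ : Valued.v ϖ = WithZero.exp (-1 : ℤ)) (hσϖ : galAdicCompletionMap (L := L) (IsCMField.complexConj L) hw ϖ = -ϖ)
    (γH : (cmDatum L 2 (Matrix.of fun i j : Fin 2 => if i.val + j.val + 1 = 2 then (1 : L) else 0)).Local v ×
      (cmDatum L 1 (Matrix.of fun i j : Fin 1 => if i.val + j.val + 1 = 1 then (1 : L) else 0)).Local v)
    (hblk : ∀ i j : Fin 2, Valued.v (((((γH.1.val : GL (Fin 2) (UnitaryGroup.LocalRing L v)).val.map (Pi.evalRingHom (fun w' : PlacesOver L v => w'.1.adicCompletion L) w))) - 1) i j) ≤ Valued.v (ϖ ^ 2))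
    (hu2 : Valued.v (finGammaTwo L v γH w - 1) ≤ Valued.v (ϖ ^ 2))
    (hirr : ¬ ∃ x : (w.1.adicCompletion L), ((((γH.1.val : GL (Fin 2) (UnitaryGroup.LocalRing L v)).val.map (Pi.evalRingHom (fun w' : PlacesOver L v => w'.1.adicCompletion L) w))).charpoly).IsRoot x)
    {n : ℕ}
    (hdisc : Valued.v ((((γH.1.val : GL (Fin 2) (UnitaryGroup.LocalRing L v)).val.map (Pi.evalRingHom (fun w' : PlacesOver L v => w'.1.adicCompletion L) w))).trace ^ 2 - 4 * (((γH.1.val : GL (Fin 2) (UnitaryGroup.LocalRing L v)).val.map (Pi.evalRingHom (fun w' : PlacesOver L v => w'.1.adicCompletion L) w))).det) = WithZero.exp (-((2 * (2 * n) : ℕ) : ℤ)))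
    (m : ℕ) (hm : Valued.v (((finCharpolyTwo L v γH).eval (finGammaTwo L v γH)) w) =
      Valued.v ((toPlace v w (HeckeCharacter.uniformizer ↥(maximalRealSubfield L) v : v.adicCompletion ↥(maximalRealSubfield L))) ^ m))
    (β : (v.adicCompletion ↥(maximalRealSubfield L))ˣ)
    (hβ : toPlace v w (β : v.adicCompletion ↥(maximalRealSubfield L)) =
      -(((finCharpolyTwo L v γH).eval (finGammaTwo L v γH)) w *
          (finGammaTwo L v γH w ^ 2 + ((γH.1.val.val : Matrix (Fin 2) (Fin 2) (LocalRing L v)).map (Pi.evalRingHom (fun w' : PlacesOver L v => w'.1.adicCompletion L) w)).det)) /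
        (2 * finGammaTwo L v γH w ^ 2 * ((γH.1.val.val : Matrix (Fin 2) (Fin 2) (LocalRing L v)).map (Pi.evalRingHom (fun w' : PlacesOver L v => w'.1.adicCompletion L) w)).det))
    (s : (w.1.adicCompletion L)ˣ)
    (hs : (s : w.1.adicCompletion L) * (((localNonsplitEquiv (IsCMField.complexConj L) (Matrix.of fun i j : Fin 1 => if i.val + j.val + 1 = 1 then (1 : L) else 0)
        (IsCMField.complexConj_ne_one L) w hw γH.2).val : GL (Fin 1) (w.1.adicCompletion L)) : Matrix (Fin 1) (Fin 1) (w.1.adicCompletion L)) 0 0 = 1)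
    (k : GL (Fin 2) (w.1.adicCompletion L))
    (hk : k ∈ unitaryGroupOfForm (galAdicCompletionMap (L := L) (IsCMField.complexConj L) hw)
      (placeForm (Matrix.of fun i j : Fin 2 => if i.val + j.val + 1 = 2 then (1 : L) else 0) w.1))
    (γ : unitaryGroupOfForm (galAdicCompletionMap (L := L) (IsCMField.complexConj L) hw) ((StdForm.antidiagonal 3).over (w.1.adicCompletion L)))
    (hγ : (γ : GL (Fin 3) (w.1.adicCompletion L)) = endoGL (k⁻¹ * (Matrix.GeneralLinearGroup.scalar (Fin 2) s *
        ((localNonsplitEquiv (IsCMField.complexConj L) (Matrix.of fun i j : Fin 2 => if i.val + j.val + 1 = 2 then (1 : L) else 0)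
          (IsCMField.complexConj_ne_one L) w hw γH.1).val : GL (Fin 2) (w.1.adicCompletion L))) * k, (1 : GL (Fin 1) (w.1.adicCompletion L))))
    (k' a : ℕ) (hmk : m = 2 * k' + 3) (hna : n = a + k' + 1) :
    {x : {M : Submodule (Valued.integer (w.1.adicCompletion L)) (Fin 3 → (w.1.adicCompletion L)) //
          IsVertex (galAdicCompletionMap (L := L) (IsCMField.complexConj L) hw) ϖ ((StdForm.antidiagonal 3).over (w.1.adicCompletion L)) M} |
        latticeGraphIso (galAdicCompletionMap (L := L) (IsCMField.complexConj L) hw) ϖ ((StdForm.antidiagonal 3).over (w.1.adicCompletion L)) γ x = x ∧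
          IsSelfDualLattice (galAdicCompletionMap (L := L) (IsCMField.complexConj L) hw) ϖ ((StdForm.antidiagonal 3).over (w.1.adicCompletion L)) x.1 ∧
          x.1.map ((Matrix.toLin' (((γ : GL (Fin 3) (w.1.adicCompletion L)) : Matrix (Fin 3) (Fin 3) (w.1.adicCompletion L)) - 1)).restrictScalars
            (Valued.integer (w.1.adicCompletion L))) ≤ scaleLattice (ϖ ^ m) x.1}.ncard =
      (Nat.card (𝓞 ↥(maximalRealSubfield L) ⧸ v.asIdeal) + 1) * ∑ i ∈ Finset.range a, Nat.card (𝓞 ↥(maximalRealSubfield L) ⧸ v.asIdeal) ^ i := by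
  have hϖ0 : ϖ ≠ 0 := fun h0 => by rw [h0, map_zero] at hϖ; exact WithZero.coe_ne_zero hϖ.symm
  -- the dictionary: regime B, `|2û − tr ĝ| = |ϖ^m|`
  obtain ⟨hle, hB, -⟩ := typeTwo_depthDictionary_even_ram L w hw he h2 ϖ hϖ hσϖ hblk hu2 hirr hdisc m hm β hβ
  have hmN : m < 2 * n := by omega
  have hsc := (hB hmN).2.2.2.le
  -- FILE 4: the root region is A-p12's centred ball of `ĝ_w` at scale `ϖ^m`
  rw [ncard_rootRegion_rerootedCentred_eq_ncard_ball_ram L w hw he h2 ϖ hϖ γH m hm s hs k hk γ hγ m le_rfl hsc]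
  -- odd-scale collapse `ϖ^{2(k′+1)+1} ↝ ϖ^{2(k′+1)}` (`N = 2n ≠ 2(k′+1)`), then the even-depth ball count at `j = k′ + 1`
  have e := selfDual_fixed_ball_odd_scale_eq L v w hw he h2 (Units.mk0 ϖ hϖ0) hϖ hσϖ (ϖ' := ϖ) _
    (localNonsplitEquiv (IsCMField.complexConj L) _ (IsCMField.complexConj_ne_one L) w hw γH.1).2 hblk (N := 2 * n) hdisc (j := k' + 1) (by omega)
  have c := ncard_selfDual_fixed_ball_of_even_depth_ramified L v w hw he h2 (Units.mk0 ϖ hϖ0) hϖ hσϖ γH.1 hirr hblk hdisc (j := k' + 1) (by omega)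
  simp only [Units.val_mk0] at e c
  rw [show m = 2 * (k' + 1) + 1 by omega, e, c, show n - (k' + 1) = a by omega]

set_option maxHeartbeats 800000 in
-- budget only: statement-heavy CM tokens.
/-- **`#R` OF THE HYPERBOLIC LITERAL, `N = 2n+1`** (`m = 2k′ + 3`, `n = a + k′ + 1`; regime B for `a ≥ 1`, and the boundary `a = 0` = regime A-odd ∕ C, `#R = 1`): `#R + 1 = 2·Σ_{i<a+1} q^i`
(the keeper's `R = (q+1)Σ_{i<a}q^i + q^a`).
FILE 4 ∘ ★ A-p12 odd-scale collapse ∘ ★ A-p12 odd-depth ball count; scalar depth = clause 2 of ★ `typeTwo_depthDictionary_odd_ram`. [cite: Kottwitz1986, §3] [cite: Rogawski1990, §4.9 Lemma 4.9.3] [cite: LabesseLanglands1979, §2 Lemma 2.1] -/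
theorem ncard_rootRegion_hyperbolic_of_odd_B_ram (he : v.asIdeal.ramificationIdx' w.1.asIdeal ≠ 1)
    (h2 : IsUnit (2 : (ValuativeRel.valuation (w.1.adicCompletion L)).integer))
    (ϖ : w.1.adicCompletion L) (hϖ : Valued.v ϖ = WithZero.exp (-1 : ℤ)) (hσϖ : galAdicCompletionMap (L := L) (IsCMField.complexConj L) hw ϖ = -ϖ)
    (γH : (cmDatum L 2 (Matrix.of fun i j : Fin 2 => if i.val + j.val + 1 = 2 then (1 : L) else 0)).Local v ×
      (cmDatum L 1 (Matrix.of fun i j : Fin 1 => if i.val + j.val + 1 = 1 then (1 : L) else 0)).Local v)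
    (hblk : ∀ i j : Fin 2, Valued.v (((((γH.1.val : GL (Fin 2) (UnitaryGroup.LocalRing L v)).val.map (Pi.evalRingHom (fun w' : PlacesOver L v => w'.1.adicCompletion L) w))) - 1) i j) ≤ Valued.v (ϖ ^ 2))
    (hu2 : Valued.v (finGammaTwo L v γH w - 1) ≤ Valued.v (ϖ ^ 2))
    (hirr : ¬ ∃ x : (w.1.adicCompletion L), ((((γH.1.val : GL (Fin 2) (UnitaryGroup.LocalRing L v)).val.map (Pi.evalRingHom (fun w' : PlacesOver L v => w'.1.adicCompletion L) w))).charpoly).IsRoot x)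
    {n : ℕ}
    (hdisc : Valued.v ((((γH.1.val : GL (Fin 2) (UnitaryGroup.LocalRing L v)).val.map (Pi.evalRingHom (fun w' : PlacesOver L v => w'.1.adicCompletion L) w))).trace ^ 2 - 4 * (((γH.1.val : GL (Fin 2) (UnitaryGroup.LocalRing L v)).val.map (Pi.evalRingHom (fun w' : PlacesOver L v => w'.1.adicCompletion L) w))).det) = WithZero.exp (-((2 * (2 * n + 1) : ℕ) : ℤ)))
    (m : ℕ) (hm : Valued.v (((finCharpolyTwo L v γH).eval (finGammaTwo L v γH)) w) =
      Valued.v ((toPlace v w (HeckeCharacter.uniformizer ↥(maximalRealSubfield L) v : v.adicCompletion ↥(maximalRealSubfield L))) ^ m))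
    (β : (v.adicCompletion ↥(maximalRealSubfield L))ˣ)
    (hβ : toPlace v w (β : v.adicCompletion ↥(maximalRealSubfield L)) =
      -(((finCharpolyTwo L v γH).eval (finGammaTwo L v γH)) w *
          (finGammaTwo L v γH w ^ 2 + ((γH.1.val.val : Matrix (Fin 2) (Fin 2) (LocalRing L v)).map (Pi.evalRingHom (fun w' : PlacesOver L v => w'.1.adicCompletion L) w)).det)) /
        (2 * finGammaTwo L v γH w ^ 2 * ((γH.1.val.val : Matrix (Fin 2) (Fin 2) (LocalRing L v)).map (Pi.evalRingHom (fun w' : PlacesOver L v => w'.1.adicCompletion L) w)).det))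
    (s : (w.1.adicCompletion L)ˣ)
    (hs : (s : w.1.adicCompletion L) * (((localNonsplitEquiv (IsCMField.complexConj L) (Matrix.of fun i j : Fin 1 => if i.val + j.val + 1 = 1 then (1 : L) else 0)
        (IsCMField.complexConj_ne_one L) w hw γH.2).val : GL (Fin 1) (w.1.adicCompletion L)) : Matrix (Fin 1) (Fin 1) (w.1.adicCompletion L)) 0 0 = 1)
    (k : GL (Fin 2) (w.1.adicCompletion L))
    (hk : k ∈ unitaryGroupOfForm (galAdicCompletionMap (L := L) (IsCMField.complexConj L) hw)
      (placeForm (Matrix.of fun i j : Fin 2 => if i.val + j.val + 1 = 2 then (1 : L) else 0) w.1))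
    (γ : unitaryGroupOfForm (galAdicCompletionMap (L := L) (IsCMField.complexConj L) hw) ((StdForm.antidiagonal 3).over (w.1.adicCompletion L)))
    (hγ : (γ : GL (Fin 3) (w.1.adicCompletion L)) = endoGL (k⁻¹ * (Matrix.GeneralLinearGroup.scalar (Fin 2) s *
        ((localNonsplitEquiv (IsCMField.complexConj L) (Matrix.of fun i j : Fin 2 => if i.val + j.val + 1 = 2 then (1 : L) else 0)
          (IsCMField.complexConj_ne_one L) w hw γH.1).val : GL (Fin 2) (w.1.adicCompletion L))) * k, (1 : GL (Fin 1) (w.1.adicCompletion L))))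
    (k' a : ℕ) (hmk : m = 2 * k' + 3) (hna : n = a + k' + 1) :
    {x : {M : Submodule (Valued.integer (w.1.adicCompletion L)) (Fin 3 → (w.1.adicCompletion L)) //
          IsVertex (galAdicCompletionMap (L := L) (IsCMField.complexConj L) hw) ϖ ((StdForm.antidiagonal 3).over (w.1.adicCompletion L)) M} |
        latticeGraphIso (galAdicCompletionMap (L := L) (IsCMField.complexConj L) hw) ϖ ((StdForm.antidiagonal 3).over (w.1.adicCompletion L)) γ x = x ∧
          IsSelfDualLattice (galAdicCompletionMap (L := L) (IsCMField.complexConj L) hw) ϖ ((StdForm.antidiagonal 3).over (w.1.adicCompletion L)) x.1 ∧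
          x.1.map ((Matrix.toLin' (((γ : GL (Fin 3) (w.1.adicCompletion L)) : Matrix (Fin 3) (Fin 3) (w.1.adicCompletion L)) - 1)).restrictScalars
            (Valued.integer (w.1.adicCompletion L))) ≤ scaleLattice (ϖ ^ m) x.1}.ncard + 1 =
      2 * ∑ i ∈ Finset.range (a + 1), Nat.card (𝓞 ↥(maximalRealSubfield L) ⧸ v.asIdeal) ^ i := by
  have hϖ0 : ϖ ≠ 0 := fun h0 => by rw [h0, map_zero] at hϖ; exact WithZero.coe_ne_zero hϖ.symm
  -- the dictionary: regime B, `|2û − tr ĝ| = |ϖ^m|`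
  obtain ⟨hle, hB, hA⟩ := typeTwo_depthDictionary_odd_ram L w hw he h2 ϖ hϖ hσϖ hblk hu2 hirr hdisc m hm β hβ
  -- regime B (`m < N`): clause 2 gives `=`; the boundary case `a = 0` (`m = N`, regime A-odd ∕ C) is clause 3's `≤` — the count below is the same formula
  have hsc : Valued.v (2 * finGammaTwo L v γH w - ((((γH.1.val : GL (Fin 2) (UnitaryGroup.LocalRing L v)).val.map
      (Pi.evalRingHom (fun w' : PlacesOver L v => w'.1.adicCompletion L) w)))).trace) ≤ Valued.v (ϖ ^ m) := by
    rcases hle.lt_or_eq with hlt | heq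
    · exact (hB hlt).2.2.2.le
    · rw [heq]; exact (hA heq).2
  -- FILE 4: the root region is A-p12's centred ball of `ĝ_w` at scale `ϖ^m`
  rw [ncard_rootRegion_rerootedCentred_eq_ncard_ball_ram L w hw he h2 ϖ hϖ γH m hm s hs k hk γ hγ m le_rfl hsc]
  -- odd-scale collapse `ϖ^{2(k′+1)+1} ↝ ϖ^{2(k′+1)}` (`N = 2n ≠ 2(k′+1)`), then the even-depth ball count at `j = k′ + 1`
  have e := selfDual_fixed_ball_odd_scale_eq L v w hw he h2 (Units.mk0 ϖ hϖ0) hϖ hσϖ (ϖ' := ϖ) _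
    (localNonsplitEquiv (IsCMField.complexConj L) _ (IsCMField.complexConj_ne_one L) w hw γH.1).2 hblk (N := 2 * n + 1) hdisc (j := k' + 1) (by omega)
  have c := ncard_selfDual_fixed_ball_of_odd_depth_ramified L v w hw he h2 (Units.mk0 ϖ hϖ0) hϖ hσϖ γH.1 hirr hblk hdisc (j := k' + 1) (by omega)
  simp only [Units.val_mk0] at e c
  rw [show m = 2 * (k' + 1) + 1 by omega, e, c, show n - (k' + 1) + 1 = a + 1 by omega]

end Literature.NumberTheory.Rogawski1990.BlockLawHyp

end
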